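/-
Copyright (c) 2026. All rights reserved.
Released under Apache 2.0 license as described in the file LICENSE.
-/
import Literature.AlgebraicGeometry.ComplexMultiplication.HyperellipticJacobianCMCurveSquareTimesSimpleFourfoldWeilType
import Literature.AlgebraicGeometry.ComplexMultiplication.HyperellipticJacobianFourTimesPrimeSimpleFactorExceptionalClasses
import Literature.AlgebraicGeometry.ComplexMultiplication.SimpleIffPrimitiveCMType
import Literature.AlgebraicGeometry.Pohlmann1968.CorankOneCMFamilyWeilSection
import HarnessLib

/-!
# `Z = X_8 × Y_{40} ∼ E'² × Y_{40}` IS AN ABELIAN SIXFOLD OF WEIL TYPE `(3, 3)` FOR `k = ℚ(√−2)` whose Weil plane `W_k ⊂ H⁶(Z)` is NOT inside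
# `D³ ⊗ ℂ` — Moonen–Zarhin §5 Case 2 («`Z := E² × Y` … `W_k ⊂ H⁶(Z, ℚ)` consists of Hodge classes») at the level of HODGE STRUCTURES, inside `J_{40}`

Family `hodge`, cell `pub-hodgecm2` (COR-CM), KEPT Literature lane `lit-deligne-3` (generation 56, file F53; sequel of F50
`HyperellipticJacobianCMCurveSquareTimesSimpleFourfoldWeilType` (CM-type level: multiplicities `(3,3)`), F43 (a `(3,3)`-class on `E'² × Y_{40}`),
F47 (`(1,3)` on `Ψ_{40}`) and F51a `Pohlmann1968/CorankOneCMFamilyWeilSection` (Weil fibres of CM-algebra families)).  THEOREMS ONLY: no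
definition, no named fact, no `sorry`, no instance; D-0026 net debt `0`.  HC_CM is NOT proved.

THE SETTING.  The pair family `(K_0, L_1; Ψ_0, Ψ_1)`: `K_0 = ℚ(ζ_8)` kept WHOLE (`L_0 = ⊤`, `Ψ_0 = Φ_8` the lower-half type; its realisations are
the abelian SURFACES `X_8 ∼ E'²`, `E'` the CM curve of `ℚ(√−2)`), and `(L_1; Ψ_1)` the index-2 sub-pair of `ℚ(ζ_{40})` realised by the SIMPLE fourfold
`Y_{40}` (`X_{40} ∼ Y_{40}²`).  The element `a = (a_0, a_1) = (ζ_8⁷ − ζ_8^{−7}, ζ_{40}⁵ − ζ_{40}^{−5}) ∈ 𝓞_{K_0} × 𝓞_{L_1}` has `a_i² = −2` (a diagonal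
`√−2`), and `T_a = {(i, s) : s(a_i) = i√2}` is its Weil fibre (`m = 3 = dim Z / 2`, `d = 2`).

WHAT IS PROVED.
* §1 (general CM-algebra lemmas, namespace `Pohlmann1968.CMAlgebra`): **`not_mem_pohlmannDivisorSetsAlg_of_sameSlot`** — the SINGLE-SLOT OBSTRUCTION:
  if a weight `S` contains `(i₀, ρ)` with `ρ ∉ Φ_{i₀}`, all members of `S` lying in their types sit in slot `i₀`, `Φ_{i₀}` is primitive and
  `(i₀, ρ̄) ∉ S`, then `S` is not a disjoint union of balanced pairs (a balanced pair through `(i₀, ρ)` would have to be `{ρ, ρ̄}` in slot `i₀`);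
  **`not_weightClassesAlg_le_divisorClassesSpan`** — the weight line of a balanced NON-divisorial weight is not inside `D^m ⊗ ℂ` (monomial basis).
* §2 data: `a_i² = −2`; `[K_0:ℚ] = 4`, `[L_1:ℚ] = 8`, `Σ = 12 = 4·3`; `dim X_8 = 2`, `dim Y_{40} = 4`.
* §3 counts (F50, F47): `ℚ(√−2)` meets `Ψ_0 ⊔ Ψ_1` with multiplicities `(3, 3)`; refined: on `Φ_8` the value `c₈ = μ⁷ − μ^{−7}` (`μ = e^{2πi/8}`;
  `c₈ = ± i√2` is all that is used — numerically `c₈ = −i√2`) has multiplicity `2` and `−c₈` has `0`; on `Ψ_1`: `1` resp. `3`.  **`isGaloisBalancedAlg_weilFibre`** (`T_a` satisfies Pohlmann's condition),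
  **`weilFibre_mem_pohlmannSetsAlg`** (`T_a ∈ pohlmannSetsAlg Ψ 3`), **`weilFibre_not_mem_pohlmannDivisorSetsAlg`** (`T_a ∉ pohlmannDivisorSetsAlg Ψ 3`,
  by the single-slot obstruction at the member of `T_a` or `T̄_a` outside `Ψ_1` over `−c₈`).
* §4 on realisations `B_0 ⊨ (ℚ(ζ_8); Φ_8)` (`X_8`), `B_1 ⊨ (L_1; Ψ_1)` SIMPLE (`Y_{40}`), `φ = ι_0(a_0) ⊕ ι_1(a_1)`: **`isWeilType`** — `(X_8 ⊕ Y_{40}, φ)` IS OF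
  WEIL TYPE `(3, 2)` (`φ² = −2`, `i√2` has multiplicity `3` on `H^{1,0}`); **`weightClassesAlg_weilFibre_le_weilClassesOf`** (the lines of `T_a`, `T̄_a`
  lie in the Weil plane); **`not_weilClassesOf_le_divisorClassesSpan`** (`W_k ⊗ ℂ ⊄ D³ ⊗ ℂ`); **`exists_rational_weilClass_not_mem_divisorClassesSpan`**
  (a RATIONAL `(3,3)` Weil class outside `D³ ⊗ ℂ`: the plane is spanned by its rational classes); `B³(X_8 ⊕ Y_{40}) ≠ D³`.
* §5 from realisations of `(ℚ(ζ_8); Φ_8)`, `(ℚ(ζ_{40}); Φ_{40})`: `exists_data`, and the hypothesis-free **`exists_surface_fourfold_weilType_sixfold`**: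
  an abelian surface `S` (`∼ E'²`) and a SIMPLE fourfold `Y`, `φ ∈ End(S ⊕ Y)`, `φ² = −2`, `(S ⊕ Y, φ)` of Weil type `(3, 2)` whose Weil plane
  carries a rational `(3,3)`-class outside `D³ ⊗ ℂ`.

HONEST.  Moonen–Zarhin print Case 2 for `Z = E² × Y` abstractly; here `E²` is replaced by the isogenous `X_8` (kept whole, so that F50's counts on `Φ_8`
apply verbatim) — `X_8 ∼ E'²` is GGL Thm. 3.0 (5) (tree `exists_isogeny_sq_simple_of_four_dvd` at level `8`), not re-proved here.  The pair `(X_8, Y_{40})`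
has Kubota corank `2` (`rank = 5 < 6`), so F51a's trichotomy and `B• = D• ⊕ W` are NOT available and are not claimed: we prove `W ⊄ D³`, not
`B³ = D³ ⊕ W`.  Nothing asserts the algebraicity of a Weil class (`(3,2)`: a sixfold of discriminant class `2`, outside Markman's split-sixfold theorem as
typed in the tree).  No numerics.  HC_CM is NOT proved.

## References
* [MoonenZarhin1999LowDim] B. Moonen, Yu. Zarhin, Math. Ann. 315 (1999) 711–733: Introduction (g), Thm. 0.2 (3), §5 Case 2 (pp. 10–11: «Rather than
  looking at `E × Y`, let us look at `Z := E² × Y` […] the corresponding space of Weil classes `W_k ⊂ H⁶(Z, ℚ)` consists of Hodge classes»)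
  [corpus: paper:arxiv-math_9901113 pp. 1, 10–11]. [cite: MoonenZarhin1999LowDim, §5 Case 2 and Thm. 0.2 (3)]
* [vanGeemen1994HodgeAV] B. van Geemen, LNM 1594 (1994): 4.9–4.10, Lemma 5.2, Thm. 6.12. [cite: vanGeemen1994HodgeAV, 4.9 and Lemma 5.2]
* [Deligne1982HodgeCycles] P. Deligne, LNM 900 (1982): §4 Prop. 4.4. [cite: Deligne1982HodgeCycles, §4 Prop. 4.4]
* [Gordon1999HodgeAVSurvey] B. B. Gordon (1999): 9.2.2 (White), §9.2 (9.2.1), 5.13. [cite: Gordon1999HodgeAVSurvey, 9.2.2 and §9.2]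
* [GalleseGoodsonLombardo2024] Gallese–Goodson–Lombardo (2024): §3 Thm. 3.0 (5), §3.2 Lemma 11. [cite: GalleseGoodsonLombardo2024, §3 Thm. 3.0 (5)]
* [Shimura1998] G. Shimura (1998): §8.2 Prop. 26. [cite: Shimura1998, §8.2 Prop. 26]
* [GaoUllmo2025] Z. Gao, E. Ullmo (2025): Thm. 3.1. [cite: GaoUllmo2025, Thm. 3.1]
* [Washington1997] L. C. Washington: Thm. 2.5, Ch. 2. [cite: Washington1997, Thm. 2.5]
-/

noncomputable section

open CategoryTheory CategoryTheory.Limits NumberField Module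

/-! ## §1 Two general CM-algebra lemmas: the single-slot obstruction, and weight lines outside `D ⊗ ℂ` -/

namespace Literature.AlgebraicGeometry.Pohlmann1968

namespace CMAlgebra

open Literature.NumberTheory.ComplexMultiplication
open Literature.AlgebraicGeometry.Motives (AbelianVariety CMType)
open Literature.AlgebraicGeometry.HodgeTheory
open Literature.AlgebraicGeometry.ComplexMultiplication (IsCMTypeRealisation)
open Literature.AlgebraicGeometry.VanGeemen1994 (hodgeClassSpan)
open Literature.Barriers.HodgeConjecture (divisorClassesSpan)

open scoped Classical Pointwise

section SingleSlot

variable {n : ℕ} {K : Fin n → Type} [∀ i, Field (K i)] {Φ : ∀ i, CMType (K i)}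

/-- Counting a property on a two-element Finset. [folklore] -/
private theorem ncard_sep_pair {α : Type*} [DecidableEq α] {a b : α} (hab : a ≠ b) (Q : α → Prop) :
    {x | x ∈ ({a, b} : Finset α) ∧ Q x}.ncard = (if Q a then 1 else 0) + (if Q b then 1 else 0) := by
  rw [show {x | x ∈ ({a, b} : Finset α) ∧ Q x} = ↑(({a, b} : Finset α).filter Q) by rw [Finset.coe_filter],
    Set.ncard_coe_finset, Finset.filter_insert, Finset.filter_singleton]
  by_cases ha : Q a <;> by_cases hb : Q b <;> simp [ha, hb, hab]

/-- A balanced PAIR inside one slot `i₀` is a balanced pair of the member `(K_{i₀}; Φ_{i₀})`. [cite: Gordon1999HodgeAVSurvey, 9.2.2] -/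
theorem isGaloisBalanced_pair_of_isGaloisBalancedAlg {i₀ : Fin n} {ρ t : K i₀ →+* ℂ} (hne : ρ ≠ t)
    (h : IsGaloisBalancedAlg Φ ({⟨i₀, ρ⟩, ⟨i₀, t⟩} : Finset ((i : Fin n) × (K i →+* ℂ)))) :
    IsGaloisBalanced (Φ i₀) ({ρ, t} : Finset (K i₀ →+* ℂ)) := by
  intro τ
  have hne' : (⟨i₀, ρ⟩ : (i : Fin n) × (K i →+* ℂ)) ≠ ⟨i₀, t⟩ := fun h' => hne (eq_of_heq (Sigma.mk.inj h').2)
  have h' := h τ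
  rw [ncard_sep_pair hne' (fun x : (i : Fin n) × (K i →+* ℂ) => (τ : ℂ →+* ℂ).comp x.2 ∈ (Φ x.1).1),
    ncard_sep_pair hne' (fun x : (i : Fin n) × (K i →+* ℂ) => (τ : ℂ →+* ℂ).comp x.2 ∉ (Φ x.1).1)] at h'
  rw [ncard_sep_pair hne, ncard_sep_pair hne]
  exact h'

variable [∀ i, NumberField (K i)] [∀ i, IsCMField (K i)]

/-- **THE SINGLE-SLOT OBSTRUCTION TO DIVISORIALITY.**  Let `S ⊆ ⊔_i Hom(K_i, ℂ)` contain `x = (i₀, ρ)` with `ρ ∉ Φ_{i₀}`, suppose every member of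
`S` lying in its type sits in the slot `i₀`, that `Φ_{i₀}` is PRIMITIVE, and that `(i₀, ρ̄) ∉ S`.  Then `S` is not a disjoint union of balanced pairs
(in any number): the pair through `x` would consist of `x` and a member `(i₀, t)`, `t ∈ Φ_{i₀}` (balance at `τ = 1`), hence be a balanced pair of the
primitive type `Φ_{i₀}`, i.e. `t = ρ̄` (the tree's `mem_pohlmannSets_one_iff_of_isPrimitive`) — excluded.  (White's criterion «`Δ − Δ̄ ≠ ∅`» sharpened
for CM algebras.) [cite: Gordon1999HodgeAVSurvey, 9.2.2] [cite: MoonenZarhin1999LowDim, §5 Case 2] [cite: Shimura1998, §8.2 Prop. 26] -/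
theorem not_mem_pohlmannDivisorSetsAlg_of_sameSlot {i₀ : Fin n} (φ₀ : K i₀ →+* ℂ) (hprim : IsPrimitive (ℂ ≃+* ℂ) (Φ i₀).1 φ₀)
    {S : Finset ((i : Fin n) × (K i →+* ℂ))} {ρ : K i₀ →+* ℂ} (hxS : (⟨i₀, ρ⟩ : (i : Fin n) × (K i →+* ℂ)) ∈ S)
    (hρ : ρ ∉ (Φ i₀).1) (hslot : ∀ y ∈ S, y.2 ∈ (Φ y.1).1 → y.1 = i₀)
    (hconj : (⟨i₀, ComplexEmbedding.conjugate ρ⟩ : (i : Fin n) × (K i →+* ℂ)) ∉ S) (m : ℕ) :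
    S ∉ pohlmannDivisorSetsAlg Φ m := by
  -- the balanced pairs through `x = (i₀, ρ)` inside `S` do not exist
  have hpair : ∀ t ∈ pohlmannSetsAlg Φ 1, (⟨i₀, ρ⟩ : (i : Fin n) × (K i →+* ℂ)) ∈ t → ¬ t ⊆ S := by
    intro t ht hxt htS
    -- the other member of `t` lies in its type (balance at `τ = 1`)
    have hcount : {y | y ∈ t ∧ y.2 ∈ (Φ y.1).1}.ncard = 1 := by
      have := ht.2.card_eq_two_mul
      rw [ht.1] at this
      omega
    obtain ⟨y, hy⟩ := Set.ncard_eq_one.1 hcount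
    have hy' : y ∈ t ∧ y.2 ∈ (Φ y.1).1 := by
      have : y ∈ ({y} : Set ((i : Fin n) × (K i →+* ℂ))) := Set.mem_singleton y
      rw [← hy] at this
      exact this
    have hyi : i₀ = y.1 := (hslot y (htS hy'.1) hy'.2).symm
    obtain ⟨j, u⟩ := y
    dsimp only at hyi
    subst hyi
    dsimp only at hy'
    have hne : ρ ≠ u := by
      rintro rfl
      exact hρ hy'.2
    have hne' : (⟨i₀, ρ⟩ : (i : Fin n) × (K i →+* ℂ)) ≠ ⟨i₀, u⟩ := fun h' => hne (eq_of_heq (Sigma.mk.inj h').2)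
    -- `t = {x, y}`
    have hteq : t = {⟨i₀, ρ⟩, ⟨i₀, u⟩} := by
      symm
      apply Finset.eq_of_subset_of_card_le
      · intro z hz
        rcases Finset.mem_insert.1 hz with rfl | hz
        · exact hxt
        · rw [Finset.mem_singleton] at hz
          subst hz
          exact hy'.1
      · rw [ht.1, Finset.card_pair hne']
    -- hence `{ρ, u}` is a balanced pair of the primitive type `Φ_{i₀}`: `u = ρ̄`
    have hbal : IsGaloisBalanced (Φ i₀) ({ρ, u} : Finset (K i₀ →+* ℂ)) := by
      have h2 := ht.2
      rw [hteq] at h2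
      exact isGaloisBalanced_pair_of_isGaloisBalancedAlg hne h2
    have hmem : ({ρ, u} : Finset (K i₀ →+* ℂ)) ∈ pohlmannSets (Φ i₀) 1 := ⟨by rw [Finset.card_pair hne], hbal⟩
    obtain ⟨φ, hφ⟩ := (mem_pohlmannSets_one_iff_of_isPrimitive φ₀ hprim _).1 hmem
    have hu : u = ComplexEmbedding.conjugate ρ := by
      have hρmem : ρ ∈ ({φ, ComplexEmbedding.conjugate φ} : Finset (K i₀ →+* ℂ)) := by
        rw [← hφ]; exact Finset.mem_insert_self _ _
      have humem : u ∈ ({φ, ComplexEmbedding.conjugate φ} : Finset (K i₀ →+* ℂ)) := by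
        rw [← hφ]; exact Finset.mem_insert_of_mem (Finset.mem_singleton_self _)
      simp only [Finset.mem_insert, Finset.mem_singleton] at hρmem humem
      rcases hρmem with h1 | h1
      · rcases humem with h2 | h2
        · exact absurd (h1.trans h2.symm) hne
        · rw [h2, h1]
      · rcases humem with h2 | h2
        · rw [h2, h1]
          exact ((ComplexEmbedding.involutive_conjugate (K i₀)) φ).symm
        · exact absurd (h1.trans h2.symm) hne
    apply hconj
    rw [← hu]
    exact htS hy'.1
  -- induction on the number of pairs, over all sub-weights of `S` through `x`
  suffices h : ∀ (k : ℕ) (S' : Finset ((i : Fin n) × (K i →+* ℂ))), S' ⊆ S →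
      (⟨i₀, ρ⟩ : (i : Fin n) × (K i →+* ℂ)) ∈ S' → S' ∉ disjointUnionsOf (pohlmannSetsAlg Φ 1) k by
    rw [pohlmannDivisorSetsAlg_def]
    exact h m S subset_rfl hxS
  intro k
  induction k with
  | zero =>
    intro S' _ hx h
    rw [mem_disjointUnionsOf_zero] at h
    rw [h] at hx
    simp at hx
  | succ k ih =>
    intro S' hS' hx h
    rw [mem_disjointUnionsOf_succ] at h
    obtain ⟨s, hs, t, ht, hdisj, rfl⟩ := h
    rcases Finset.mem_disjUnion.1 hx with hxs | hxt
    · exact ih s (fun z hz => hS' (Finset.mem_disjUnion.2 (Or.inl hz))) hxs hs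
    · exact hpair t ht hxt (fun z hz => hS' (Finset.mem_disjUnion.2 (Or.inr hz)))

end SingleSlot

section WeightLine

variable {n : ℕ} {K : Fin n → Type} [∀ i, Field (K i)] [∀ i, NumberField (K i)]
  {Φ : ∀ i, CMType (K i)} {A : Fin n → AbelianVariety ℂ} {ι : ∀ i, 𝓞 (K i) →+* End (A i)}
  {θ : ∀ i, K i →+* Module.End ℂ (complexBetti (A i).X 1)}

/-- **The weight line of a NON-divisorial weight is not inside `D^m ⊗ ℂ`**: for `S ∉ pohlmannDivisorSetsAlg Φ m` with `|S| = 2m`, the line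
`H^{2m}(⨁ A_i)_S` is not contained in `divisorClassesSpan` (its basis monomial `w_S` lies in `D^m ⊗ ℂ` iff `S` is a disjoint union of balanced
pairs — the tree's `cupMonomial_mem_divisorClassesSpan_iff`). [cite: Gordon1999HodgeAVSurvey, 9.2.2] [cite: GaoUllmo2025, Thm. 3.1] -/
theorem not_weightClassesAlg_le_divisorClassesSpan (hA : ∀ i, IsCMTypeRealisation (Φ i) (A i) (ι i) (θ i)) {m : ℕ}
    {S : Finset ((i : Fin n) × (K i →+* ℂ))} (hS : S.card = 2 * m) (hSD : S ∉ pohlmannDivisorSetsAlg Φ m) :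
    ¬ weightClassesAlg A ι (2 * m) S ≤ divisorClassesSpan (⨁ A).X (⨁ A).dim m := by
  letI : LinearOrder ((i : Fin n) × (K i →+* ℂ)) :=
    LinearOrder.lift' (Fintype.equivFin _) (Fintype.equivFin _).injective
  obtain ⟨w, hw, -, -⟩ := exists_eigenbasis_biproduct hA
  obtain ⟨b, hb⟩ := exists_monomialBasis w (2 * m)
  obtain ⟨b₂, hb₂⟩ := exists_monomialBasis w 2
  have hT : ∀ t ∈ pohlmannSetsAlg Φ 1, t.card = 2 := fun t ht => ht.1
  have hB1 : hodgeClassSpan (⨁ A).dim (⨁ A).X 1 = Submodule.span ℂ (cupMonomial w 2 ''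
      {t : Set.powersetCard ((i : Fin n) × (K i →+* ℂ)) 2 | (t : Finset ((i : Fin n) × (K i →+* ℂ))) ∈ pohlmannSetsAlg Φ 1}) := by
    rw [hodgeClassSpan_biproduct_eq_span_image hA hw (m := 1) hb₂]
    exact congrArg _ (Set.image_congr' hb₂)
  let u : Set.powersetCard ((i : Fin n) × (K i →+* ℂ)) (2 * m) := Set.powersetCard.ofCard hS
  intro hle
  have hbu : b u ∈ weightClassesAlg A ι (2 * m) S := by
    have h := weightClassesAlg_eq_span_singleton (A := A) (ι := ι) hw hb u
    rw [show ((u : Finset ((i : Fin n) × (K i →+* ℂ)))) = S from rfl] at h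
    rw [h]
    exact Submodule.mem_span_singleton_self _
  have huD : b u ∉ divisorClassesSpan (⨁ A).X (⨁ A).dim m := by
    rw [show b u = cupMonomial w (2 * m) u from hb u, cupMonomial_mem_divisorClassesSpan_iff w hT hB1 hb u, ← pohlmannDivisorSetsAlg_def]
    exact hSD
  exact huD (hle hbu)

end WeightLine

end CMAlgebra

end Literature.AlgebraicGeometry.Pohlmann1968


/-! ## §2 The data of `X_8 ⊕ Y_{40}`: `a = (ζ_8⁷ − ζ_8^{−7}, ζ_{40}⁵ − ζ_{40}^{−5})`, `a_i² = −2`, degrees `4 + 8 = 12` -/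

namespace Literature.AlgebraicGeometry.ComplexMultiplication

open Literature.AlgebraicGeometry.Motives
open Literature.AlgebraicGeometry.Motives.AbelianVariety
open Literature.AlgebraicGeometry.HodgeTheory (complexBetti IsRationalClass IsOfHodgeType IsWeilType weilClassesOf algebraicClasses
  weilClassesOf_eq_span_isRationalClass)
open Literature.AlgebraicGeometry.VanGeemen1994 (hodgeClassSpan)
open Literature.Barriers.HodgeConjecture (divisorClassesSpan)
open Literature.NumberTheory.ComplexMultiplication
open Literature.AlgebraicGeometry.ComplexMultiplication.CMWeights

namespace HyperellipticJacobian

namespace WeilPlaneForty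

open Literature.AlgebraicGeometry.Pohlmann1968 Literature.AlgebraicGeometry.Pohlmann1968.Cyclotomic
open Literature.AlgebraicGeometry.Pohlmann1968.CMAlgebra

open scoped Classical Pointwise

section Data

variable {lev : Fin 2 → ℕ} [∀ i, NeZero (lev i)] {K : Fin 2 → Type} [∀ i, Field (K i)] [∀ i, NumberField (K i)]
  [∀ i, IsCyclotomicExtension {lev i} ℚ (K i)] {Φ : ∀ i, CMType (K i)}
  {L : ∀ i, IntermediateField ℚ (K i)} {Ψ : ∀ i, CMType (L i)}

omit [∀ i, NeZero (lev i)] [∀ i, NumberField (K i)] [∀ i, IsCyclotomicExtension {lev i} ℚ (K i)] in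
/-- `2 < 8, 40`. [folklore] -/
private theorem two_lt_lev (h0 : lev 0 = 8) (h1 : lev 1 = 40) : ∀ i, 2 < lev i :=
  Fin.forall_fin_two.2 ⟨by rw [h0]; norm_num, by rw [h1]; norm_num⟩

omit [∀ i, NeZero (lev i)] in
/-- The cyclotomic members are CM fields (levels `> 2`). [cite: Washington1997, Thm. 2.5] -/
private theorem isCMField_lev (h2 : ∀ i, 2 < lev i) (i : Fin 2) : IsCMField (K i) :=
  IsCyclotomicExtension.Rat.isCMField (K i) (S := {lev i}) ⟨lev i, rfl, h2 i⟩

omit [∀ i, NeZero (lev i)] in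
/-- The sub-pair fields `L_i` are CM fields. [cite: Shimura1998, §8.2 Prop. 26] -/
private theorem isCMField_sub (h2 : ∀ i, 2 < lev i) (Ψ : ∀ i, CMType (L i)) (i : Fin 2) : IsCMField (L i) := by
  haveI : IsCMField (K i) := isCMField_lev h2 i
  exact isCMField_of_cmType_intermediateField (L i) (Ψ i)

/-- `(u − u^{−1})² = −2` whenever `u⁴ = −1` (`u^{−1} = −u³`). [cite: Washington1997, Ch. 2 (basic cyclotomic relations)] -/
private theorem sub_inv_sq_of_pow_four {F : Type*} [Field F] {u : F} (hu : u ^ 4 = -1) : (u - u⁻¹) ^ 2 = -2 := by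
  have hinv : u⁻¹ = -u ^ 3 := inv_eq_of_mul_eq_one_right (by rw [mul_neg, ← pow_succ', hu, neg_neg])
  rw [hinv]
  calc (u - -u ^ 3) ^ 2 = u ^ 2 * (1 + u ^ 4) + 2 * u ^ 4 := by ring
    _ = -2 := by rw [hu]; ring

/-- `(ζ_8⁷)⁴ = −1` and `(ζ_{40}⁵)⁴ = −1`. [cite: Washington1997, Ch. 2] -/
theorem pow_exp_pow_four_eq_neg_one (h0 : lev 0 = 8) (h1 : lev 1 = 40) :
    ∀ i, (zetaOf (lev i) (K i) ^ ((![7, 5] : Fin 2 → ℕ) i)) ^ 4 = -1 := by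
  refine Fin.forall_fin_two.2 ⟨?_, ?_⟩
  · have hζ : IsPrimitiveRoot (zetaOf (lev 0) (K 0)) (lev 0) := IsCyclotomicExtension.zeta_spec (lev 0) ℚ (K 0)
    have h4 : zetaOf (lev 0) (K 0) ^ 4 = -1 :=
      (hζ.pow (by rw [h0]; norm_num) (show lev 0 = 4 * 2 by rw [h0])).eq_neg_one_of_two_right
    show (zetaOf (lev 0) (K 0) ^ 7) ^ 4 = -1
    rw [← pow_mul, show 7 * 4 = 4 * 7 by rfl, pow_mul, h4]
    norm_num
  · have hζ : IsPrimitiveRoot (zetaOf (lev 1) (K 1)) (lev 1) := IsCyclotomicExtension.zeta_spec (lev 1) ℚ (K 1)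
    show (zetaOf (lev 1) (K 1) ^ 5) ^ 4 = -1
    rw [← pow_mul]
    exact (hζ.pow (by rw [h1]; norm_num) (show lev 1 = 5 * 4 * 2 by rw [h1])).eq_neg_one_of_two_right

/-- **`a_i² = −2`**: `(ζ_8⁷ − ζ_8^{−7})² = −2 = (ζ_{40}⁵ − ζ_{40}^{−5})²` — `a = (a_0, a_1)` is a diagonal `√−2` in `𝓞_{K_0} × 𝓞_{L_1}`.
[cite: MoonenZarhin1999LowDim, §5 Case 2] [cite: Washington1997, Ch. 2 (basic cyclotomic relations)] -/
theorem sq_a_eq (h0 : lev 0 = 8) (h1 : lev 1 = 40) (a : ∀ i, 𝓞 (L i))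
    (ha : ∀ i, (((a i : L i)) : K i) = zetaOf (lev i) (K i) ^ ((![7, 5] : Fin 2 → ℕ) i) - (zetaOf (lev i) (K i) ^ ((![7, 5] : Fin 2 → ℕ) i))⁻¹) :
    ∀ i, a i * a i = -((2 : ℕ) : 𝓞 (L i)) := by
  intro i
  have hK := sub_inv_sq_of_pow_four (pow_exp_pow_four_eq_neg_one (K := K) h0 h1 i)
  rw [← ha i] at hK
  have hL : ((a i : 𝓞 (L i)) : L i) ^ 2 = -2 := by
    apply (algebraMap (L i) (K i)).injective
    rw [map_pow, map_neg, map_ofNat]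
    exact hK
  apply RingOfIntegers.ext
  show algebraMap (𝓞 (L i)) (L i) (a i * a i) = algebraMap (𝓞 (L i)) (L i) (-((2 : ℕ) : 𝓞 (L i)))
  rw [map_mul, map_neg, map_natCast, Nat.cast_ofNat, ← sq]
  exact hL

/-- **`[L_0:ℚ] = 4` (`L_0 = ℚ(ζ_8)`, `φ(8) = 4`) and `[L_1:ℚ] = 8` (index `2` in `ℚ(ζ_{40})`, `φ(40) = 16`)**; so `Σ_i [L_i:ℚ] = 12 = 2 dim(X_8 × Y_{40})`.
[cite: GalleseGoodsonLombardo2024, §3 Thm. 3.0 (5)] [cite: Washington1997, Thm. 2.5] -/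
theorem finrank_eq (h0 : lev 0 = 8) (h1 : lev 1 = 40) (hL0 : L 0 = ⊤) (hfin1 : Module.finrank (L 1) (K 1) = 2) :
    finrank ℚ (L 0) = 4 ∧ finrank ℚ (L 1) = 8 := by
  have hK : ∀ i, finrank ℚ (K i) = (lev i).totient := fun i =>
    IsCyclotomicExtension.finrank (K := ℚ) (n := lev i) (K i) (Polynomial.cyclotomic.irreducible_rat (Nat.pos_of_ne_zero (NeZero.ne _)))
  constructor
  · have h := hK 0
    rw [h0, show Nat.totient 8 = 4 by decide] at h
    rw [hL0, IntermediateField.finrank_top', h]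
  · have htower := Module.finrank_mul_finrank ℚ (L 1) (K 1)
    rw [hfin1, hK 1, h1, show Nat.totient 40 = 16 by decide] at htower
    omega

/-- `Σ_i [L_i : ℚ] = 12 = 4 · 3`. [cite: GalleseGoodsonLombardo2024, §3 Thm. 3.0 (5)] -/
theorem sum_finrank_eq (h0 : lev 0 = 8) (h1 : lev 1 = 40) (hL0 : L 0 = ⊤) (hfin1 : Module.finrank (L 1) (K 1) = 2) :
    ∑ i, finrank ℚ (L i) = 12 := by
  obtain ⟨hd0, hd1⟩ := finrank_eq (K := K) h0 h1 hL0 hfin1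
  rw [Fin.sum_univ_two, hd0, hd1]

end Data


/-! ## §3 The Weil fibre `T_a = {(i,s) : s(a_i) = i√2}`: balanced (multiplicities `(3,3)`), of degree `3`, and NOT a divisor weight -/

section Counts

variable {lev : Fin 2 → ℕ} [∀ i, NeZero (lev i)] {K : Fin 2 → Type} [∀ i, Field (K i)] [∀ i, NumberField (K i)]
  [∀ i, IsCyclotomicExtension {lev i} ℚ (K i)] {Φ : ∀ i, CMType (K i)}
  {L : ∀ i, IntermediateField ℚ (K i)} {Ψ : ∀ i, CMType (L i)}

omit [∀ i, NeZero (lev i)] [∀ i, IsCyclotomicExtension {lev i} ℚ (K i)] in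
/-- A count on `⊔_i Hom(L_i, ℂ)` is the sum of the slot counts. [cite: GaoUllmo2025, Thm. 3.1 (3.2)] -/
private theorem ncard_sigma_eq_sum' (Q : ∀ i, (L i →+* ℂ) → Prop) :
    {x : (i : Fin 2) × (L i →+* ℂ) | Q x.1 x.2}.ncard = ∑ i, {s : L i →+* ℂ | Q i s}.ncard := by
  have hset : {x : (i : Fin 2) × (L i →+* ℂ) | Q x.1 x.2} =
      ↑(Finset.univ.sigma fun i => Finset.univ.filter fun s : L i →+* ℂ => Q i s) := by
    ext x
    simp only [Set.mem_setOf_eq, Finset.coe_sigma, Set.mem_sigma_iff, Finset.mem_coe, Finset.mem_univ, Finset.mem_filter, true_and]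
  rw [hset, Set.ncard_coe_finset, Finset.card_sigma]
  refine Finset.sum_congr rfl fun i _ => ?_
  rw [show {s : L i →+* ℂ | Q i s} = ↑(Finset.univ.filter fun s : L i →+* ℂ => Q i s) by
    ext s; simp only [Set.mem_setOf_eq, Finset.coe_filter, Finset.mem_univ, true_and], Set.ncard_coe_finset]

omit [∀ i, NeZero (lev i)] [∀ i, IsCyclotomicExtension {lev i} ℚ (K i)] in
/-- Counts along a sub-pair `(L ≤ K; Ψ)`, `Ψ^K = Φ`: `#{σ ∈ Φ : σ(x) = c} = [K : L] · #{ρ ∈ Ψ : ρ(x) = c}`. [cite: Shimura1998, §8.3] -/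
private theorem ncard_restrict_eq_mul' (i : Fin 2) (hind : inducedCMType (algebraMap (L i) (K i)) (Ψ i) = Φ i) (x : L i) (c : ℂ) :
    {σ : K i →+* ℂ | σ ∈ (Φ i).1 ∧ σ (x : K i) = c}.ncard = Module.finrank (L i) (K i) * {ρ : L i →+* ℂ | ρ ∈ (Ψ i).1 ∧ ρ x = c}.ncard := by
  have h := card_filter_comp_mem (K := K i) (L := L i) (Finset.univ.filter fun ρ : L i →+* ℂ => ρ ∈ (Ψ i).1 ∧ ρ x = c)
  have e1 : {σ : K i →+* ℂ | σ ∈ (Φ i).1 ∧ σ (x : K i) = c} = ↑(Finset.univ.filter fun σ : K i →+* ℂ =>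
      σ.comp (algebraMap (L i) (K i)) ∈ (Finset.univ.filter fun ρ : L i →+* ℂ => ρ ∈ (Ψ i).1 ∧ ρ x = c)) := by
    ext σ
    simp only [Set.mem_setOf_eq, Finset.coe_filter, Finset.mem_filter, Finset.mem_univ, true_and, RingHom.coe_comp,
      Function.comp_apply, ← hind, mem_inducedCMType_iff]
    rfl
  have e2 : {ρ : L i →+* ℂ | ρ ∈ (Ψ i).1 ∧ ρ x = c} = ↑(Finset.univ.filter fun ρ : L i →+* ℂ => ρ ∈ (Ψ i).1 ∧ ρ x = c) := by
    ext ρ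
    simp only [Set.mem_setOf_eq, Finset.coe_filter, Finset.mem_univ, true_and]
  rw [e1, e2, Set.ncard_coe_finset, Set.ncard_coe_finset, h]

/-- `(i√2)² = −2`. [folklore] -/
private theorem I_mul_sqrt_two_sq : (Complex.I * (Real.sqrt ((2 : ℕ) : ℝ) : ℂ)) ^ 2 = -2 := by
  rw [mul_pow, Complex.I_sq, ← Complex.ofReal_pow, Nat.cast_ofNat, Real.sq_sqrt (by norm_num)]
  push_cast
  ring

/-- A complex number with square `−2` is `± i√2`. [folklore] -/
private theorem eq_or_eq_neg_of_sq_eq_neg_two {c : ℂ} (hc : c ^ 2 = -2) :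
    c = Complex.I * (Real.sqrt ((2 : ℕ) : ℝ) : ℂ) ∨ c = -(Complex.I * (Real.sqrt ((2 : ℕ) : ℝ) : ℂ)) :=
  sq_eq_sq_iff_eq_or_eq_neg.1 (by rw [hc, I_mul_sqrt_two_sq])

/-- **The slot counts** (F50 read on the family `(Ψ_0 = Φ_8^⊤, Ψ_1)`): for `c ∈ {i√2, −i√2}`,
`#{s ∈ Ψ_0 : s(a_0) = c} + #{ρ ∈ Ψ_1 : ρ(a_1) = c} = 3` — `k = ℚ(√−2)` meets `Ψ_0 ⊔ Ψ_1` with multiplicities `(3, 3)`.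
[cite: MoonenZarhin1999LowDim, §5 Case 2] [cite: vanGeemen1994HodgeAV, 4.9] -/
theorem sum_ncard_slots_eq (h0 : lev 0 = 8) (h1 : lev 1 = 40)
    (hΦ : ∀ i (σ : K i →+* ℂ), σ ∈ (Φ i).1 ↔ 2 * (expOf (lev i) (K i) σ).val < lev i)
    (hind : ∀ i, inducedCMType (algebraMap (L i) (K i)) (Ψ i) = Φ i) (hL0 : L 0 = ⊤) (hfin1 : Module.finrank (L 1) (K 1) = 2)
    (a : ∀ i, 𝓞 (L i))
    (ha : ∀ i, (((a i : L i)) : K i) = zetaOf (lev i) (K i) ^ ((![7, 5] : Fin 2 → ℕ) i) - (zetaOf (lev i) (K i) ^ ((![7, 5] : Fin 2 → ℕ) i))⁻¹) :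
    (∑ i, {s : L i →+* ℂ | s ∈ (Ψ i).1 ∧ s (a i : L i) = Complex.I * (Real.sqrt ((2 : ℕ) : ℝ) : ℂ)}.ncard) = 3 ∧
      (∑ i, {s : L i →+* ℂ | s ∈ (Ψ i).1 ∧ s (a i : L i) = -(Complex.I * (Real.sqrt ((2 : ℕ) : ℝ) : ℂ))}.ncard) = 3 := by
  have hw : zetaOf (lev 1) (K 1) ^ 5 - (zetaOf (lev 1) (K 1) ^ 5)⁻¹ ∈ L 1 := by
    have h := (a 1 : L 1).2
    rw [show ((a 1 : L 1) : K 1) = zetaOf (lev 1) (K 1) ^ 5 - (zetaOf (lev 1) (K 1) ^ 5)⁻¹ from ha 1] at h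
    exact h
  obtain ⟨c, hc2, hP, hM⟩ := weilType_multiplicities_cmCurveSq_simpleFourfold h0 h1 (Φ 0) (hΦ 0) (Φ 1) (hΦ 1) (hind 1) hfin1 hw
  have hfin0 : Module.finrank (L 0) (K 0) = 1 := by rw [hL0, IntermediateField.finrank_top]
  have e0 : ∀ c' : ℂ, {s : L 0 →+* ℂ | s ∈ (Ψ 0).1 ∧ s (a 0 : L 0) = c'}.ncard =
      {σ : K 0 →+* ℂ | σ ∈ (Φ 0).1 ∧ σ (zetaOf (lev 0) (K 0) ^ 7 - (zetaOf (lev 0) (K 0) ^ 7)⁻¹) = c'}.ncard := fun c' => by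
    rw [show zetaOf (lev 0) (K 0) ^ 7 - (zetaOf (lev 0) (K 0) ^ 7)⁻¹ = ((a 0 : L 0) : K 0) from (ha 0).symm,
      ncard_restrict_eq_mul' 0 (hind 0) (a 0 : L 0) c', hfin0, one_mul]
  have e1 : ∀ c' : ℂ, {s : L 1 →+* ℂ | s ∈ (Ψ 1).1 ∧ s (a 1 : L 1) = c'}.ncard = {ρ : L 1 →+* ℂ | ρ ∈ (Ψ 1).1 ∧ ρ ⟨_, hw⟩ = c'}.ncard :=
    fun c' => by
    have : (a 1 : L 1) = ⟨_, hw⟩ := Subtype.ext (ha 1)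
    rw [this]
  rw [Fin.sum_univ_two, Fin.sum_univ_two, e0, e0, e1, e1]
  rcases eq_or_eq_neg_of_sq_eq_neg_two hc2 with rfl | rfl
  · exact ⟨hP, hM⟩
  · rw [neg_neg] at hM
    exact ⟨hM, hP⟩

/-- **`#(T_a ∩ Σ) = 3` and `#(T̄_a ∩ Σ) = 3`** for the Weil fibre `T_a` and its conjugate (the fibre of `−i√2`).
[cite: MoonenZarhin1999LowDim, §5 Case 2] [cite: vanGeemen1994HodgeAV, 4.9 and Lemma 5.2] -/
theorem ncard_weilFibre_sep_eq (h0 : lev 0 = 8) (h1 : lev 1 = 40)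
    (hΦ : ∀ i (σ : K i →+* ℂ), σ ∈ (Φ i).1 ↔ 2 * (expOf (lev i) (K i) σ).val < lev i)
    (hind : ∀ i, inducedCMType (algebraMap (L i) (K i)) (Ψ i) = Φ i) (hL0 : L 0 = ⊤) (hfin1 : Module.finrank (L 1) (K 1) = 2)
    (a : ∀ i, 𝓞 (L i))
    (ha : ∀ i, (((a i : L i)) : K i) = zetaOf (lev i) (K i) ^ ((![7, 5] : Fin 2 → ℕ) i) - (zetaOf (lev i) (K i) ^ ((![7, 5] : Fin 2 → ℕ) i))⁻¹) :
    {x | x ∈ (Finset.univ.filter fun y : (i : Fin 2) × (L i →+* ℂ) =>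
        y.2 ((a y.1 : 𝓞 (L y.1)) : L y.1) = Complex.I * (Real.sqrt ((2 : ℕ) : ℝ) : ℂ)) ∧ x.2 ∈ (Ψ x.1).1}.ncard = 3 ∧
      {x | x ∈ (Finset.univ.filter fun y : (i : Fin 2) × (L i →+* ℂ) =>
        y.2 ((a y.1 : 𝓞 (L y.1)) : L y.1) = -(Complex.I * (Real.sqrt ((2 : ℕ) : ℝ) : ℂ))) ∧ x.2 ∈ (Ψ x.1).1}.ncard = 3 := by
  obtain ⟨hI, hnI⟩ := sum_ncard_slots_eq h0 h1 hΦ hind hL0 hfin1 a ha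
  have key : ∀ c : ℂ, {x | x ∈ (Finset.univ.filter fun y : (i : Fin 2) × (L i →+* ℂ) => y.2 ((a y.1 : 𝓞 (L y.1)) : L y.1) = c) ∧
      x.2 ∈ (Ψ x.1).1}.ncard = ∑ i, {s : L i →+* ℂ | s ∈ (Ψ i).1 ∧ s (a i : L i) = c}.ncard := fun c => by
    rw [← ncard_sigma_eq_sum' (L := L) (fun i s => s ∈ (Ψ i).1 ∧ s (a i : L i) = c)]
    congr 1
    ext x
    simp only [Set.mem_setOf_eq, Finset.mem_filter, Finset.mem_univ, true_and]
    tauto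
  exact ⟨by rw [key, hI], by rw [key, hnI]⟩

/-- **THE WEIL FIBRE `T_a` OF `X_8 × Y_{40}` SATISFIES POHLMANN'S CONDITION** (`Aut(ℂ)` moves it to itself or to `T̄_a`, F51a `smul_weilFibre_eq_or`,
and the one count balances, F51a `isGaloisBalancedAlg_of_smul_eq_or`): Moonen–Zarhin's «`W_k ⊂ H⁶(Z, ℚ)` consists of Hodge classes» at the level of
CM types (Deligne–Milne 4.4). [cite: MoonenZarhin1999LowDim, §5 Case 2] [cite: Deligne1982HodgeCycles, §4 Prop. 4.4] [cite: GaoUllmo2025, Thm. 3.1 (3.2)] -/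
theorem isGaloisBalancedAlg_weilFibre (h0 : lev 0 = 8) (h1 : lev 1 = 40)
    (hΦ : ∀ i (σ : K i →+* ℂ), σ ∈ (Φ i).1 ↔ 2 * (expOf (lev i) (K i) σ).val < lev i)
    (hind : ∀ i, inducedCMType (algebraMap (L i) (K i)) (Ψ i) = Φ i) (hL0 : L 0 = ⊤) (hfin1 : Module.finrank (L 1) (K 1) = 2)
    (a : ∀ i, 𝓞 (L i))
    (ha : ∀ i, (((a i : L i)) : K i) = zetaOf (lev i) (K i) ^ ((![7, 5] : Fin 2 → ℕ) i) - (zetaOf (lev i) (K i) ^ ((![7, 5] : Fin 2 → ℕ) i))⁻¹) :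
    IsGaloisBalancedAlg Ψ (Finset.univ.filter fun y : (i : Fin 2) × (L i →+* ℂ) =>
      y.2 ((a y.1 : 𝓞 (L y.1)) : L y.1) = Complex.I * (Real.sqrt ((2 : ℕ) : ℝ) : ℂ)) := by
  haveI : ∀ i, IsCMField (L i) := isCMField_sub (two_lt_lev h0 h1) Ψ
  have ha2 := sq_a_eq h0 h1 a ha
  obtain ⟨hI, hnI⟩ := ncard_weilFibre_sep_eq h0 h1 hΦ hind hL0 hfin1 a ha
  refine CorankOne.isGaloisBalancedAlg_of_smul_eq_or Ψ (CorankOne.smul_weilFibre_eq_or a two_pos ha2) ?_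
  have h2 := ncard_sep_conj_smul_mem Ψ (1 : ℂ ≃+* ℂ)
    (Finset.univ.filter fun y : (i : Fin 2) × (L i →+* ℂ) => y.2 ((a y.1 : 𝓞 (L y.1)) : L y.1) = Complex.I * (Real.sqrt ((2 : ℕ) : ℝ) : ℂ))
  have hone : ∀ x : (i : Fin 2) × (L i →+* ℂ), ((1 : ℂ ≃+* ℂ) : ℂ →+* ℂ).comp x.2 = x.2 := fun x => RingHom.ext fun _ => rfl
  simp only [hone] at h2
  have hconj : {x | x ∈ (starRingAut : ℂ ≃+* ℂ) • (Finset.univ.filter fun y : (i : Fin 2) × (L i →+* ℂ) =>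
      y.2 ((a y.1 : 𝓞 (L y.1)) : L y.1) = Complex.I * (Real.sqrt ((2 : ℕ) : ℝ) : ℂ)) ∧ x.2 ∈ (Ψ x.1).1}.ncard =
      {x | x ∈ (Finset.univ.filter fun y : (i : Fin 2) × (L i →+* ℂ) =>
        y.2 ((a y.1 : 𝓞 (L y.1)) : L y.1) = -(Complex.I * (Real.sqrt ((2 : ℕ) : ℝ) : ℂ))) ∧ x.2 ∈ (Ψ x.1).1}.ncard := by
    congr 1
    ext x
    simp only [Set.mem_setOf_eq]
    rw [CorankOne.mem_conj_smul_weilFibre_iff a two_pos ha2 x]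
    simp only [Finset.mem_filter, Finset.mem_univ, true_and]
  rw [hI, ← h2, hconj, hnI]

/-- **`T_a ∈ pohlmannSetsAlg Ψ 3`**: `|T_a| = 6 = dim(X_8 × Y_{40})` (a transversal of conjugation) and `T_a` is balanced — the line `H⁶(X_8 × Y_{40})_{T_a}`
consists of Hodge classes (Pohlmann ∕ Gao–Ullmo Thm. 3.1). [cite: GaoUllmo2025, Thm. 3.1] [cite: MoonenZarhin1999LowDim, §5 Case 2] -/
theorem weilFibre_mem_pohlmannSetsAlg (h0 : lev 0 = 8) (h1 : lev 1 = 40)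
    (hΦ : ∀ i (σ : K i →+* ℂ), σ ∈ (Φ i).1 ↔ 2 * (expOf (lev i) (K i) σ).val < lev i)
    (hind : ∀ i, inducedCMType (algebraMap (L i) (K i)) (Ψ i) = Φ i) (hL0 : L 0 = ⊤) (hfin1 : Module.finrank (L 1) (K 1) = 2)
    (a : ∀ i, 𝓞 (L i))
    (ha : ∀ i, (((a i : L i)) : K i) = zetaOf (lev i) (K i) ^ ((![7, 5] : Fin 2 → ℕ) i) - (zetaOf (lev i) (K i) ^ ((![7, 5] : Fin 2 → ℕ) i))⁻¹) :
    (Finset.univ.filter fun y : (i : Fin 2) × (L i →+* ℂ) =>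
        y.2 ((a y.1 : 𝓞 (L y.1)) : L y.1) = Complex.I * (Real.sqrt ((2 : ℕ) : ℝ) : ℂ)) ∈ pohlmannSetsAlg Ψ 3 := by
  haveI : ∀ i, IsCMField (L i) := isCMField_sub (two_lt_lev h0 h1) Ψ
  have ha2 := sq_a_eq h0 h1 a ha
  have hcard := CorankOne.two_mul_card_eq_sum_finrank (CorankOne.mem_weilFibre_iff_conj_smul_not_mem a two_pos ha2)
  rw [sum_finrank_eq h0 h1 hL0 hfin1] at hcard
  exact ⟨by omega, isGaloisBalancedAlg_weilFibre h0 h1 hΦ hind hL0 hfin1 a ha⟩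

/-- **The refined slot-0 count**: both members of `Φ_8` send `a_0 = ζ_8⁷ − ζ_8^{−7}` to `c₈ = μ⁷ − μ^{−7}` (`μ = e^{2πi/8}`), none to `−c₈` (F50); so
NO member of `Ψ_0 = Φ_8^⊤` lies over `−c₈` (numerically `c₈ = −i√2`; only `c₈ = ± i√2`, `rootValue_eq_or`, is used below). [cite: MoonenZarhin1999LowDim, §5 Case 2] [cite: Washington1997, Thm. 2.5] -/
theorem ncard_slot_zero_eq (h0 : lev 0 = 8)
    (hΦ : ∀ i (σ : K i →+* ℂ), σ ∈ (Φ i).1 ↔ 2 * (expOf (lev i) (K i) σ).val < lev i)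
    (hind : ∀ i, inducedCMType (algebraMap (L i) (K i)) (Ψ i) = Φ i) (hL0 : L 0 = ⊤) (a : ∀ i, 𝓞 (L i))
    (ha : ∀ i, (((a i : L i)) : K i) = zetaOf (lev i) (K i) ^ ((![7, 5] : Fin 2 → ℕ) i) - (zetaOf (lev i) (K i) ^ ((![7, 5] : Fin 2 → ℕ) i))⁻¹) :
    {s : L 0 →+* ℂ | s ∈ (Ψ 0).1 ∧ s (a 0 : L 0) = rootζ 8 ^ 7 - (rootζ 8 ^ 7)⁻¹}.ncard = 2 ∧
      {s : L 0 →+* ℂ | s ∈ (Ψ 0).1 ∧ s (a 0 : L 0) = -(rootζ 8 ^ 7 - (rootζ 8 ^ 7)⁻¹)}.ncard = 0 := by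
  obtain ⟨h2, hz⟩ := ncard_cmType_level_eight h0 (Φ 0) (hΦ 0)
  have hfin0 : Module.finrank (L 0) (K 0) = 1 := by rw [hL0, IntermediateField.finrank_top]
  have e0 : ∀ c' : ℂ, {s : L 0 →+* ℂ | s ∈ (Ψ 0).1 ∧ s (a 0 : L 0) = c'}.ncard =
      {σ : K 0 →+* ℂ | σ ∈ (Φ 0).1 ∧ σ (zetaOf (lev 0) (K 0) ^ 7 - (zetaOf (lev 0) (K 0) ^ 7)⁻¹) = c'}.ncard := fun c' => by
    rw [show zetaOf (lev 0) (K 0) ^ 7 - (zetaOf (lev 0) (K 0) ^ 7)⁻¹ = ((a 0 : L 0) : K 0) from (ha 0).symm,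
      ncard_restrict_eq_mul' 0 (hind 0) (a 0 : L 0) c', hfin0, one_mul]
  exact ⟨by rw [e0, h2], by rw [e0, hz]⟩

/-- `c₈ = μ⁷ − μ^{−7}` is `i√2` or `−i√2` (it is a value `s(a_0)`, and `a_0² = −2`). [cite: Washington1997, Thm. 2.5] -/
theorem rootValue_eq_or (h0 : lev 0 = 8) (h1 : lev 1 = 40)
    (hΦ : ∀ i (σ : K i →+* ℂ), σ ∈ (Φ i).1 ↔ 2 * (expOf (lev i) (K i) σ).val < lev i)
    (hind : ∀ i, inducedCMType (algebraMap (L i) (K i)) (Ψ i) = Φ i) (hL0 : L 0 = ⊤) (a : ∀ i, 𝓞 (L i))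
    (ha : ∀ i, (((a i : L i)) : K i) = zetaOf (lev i) (K i) ^ ((![7, 5] : Fin 2 → ℕ) i) - (zetaOf (lev i) (K i) ^ ((![7, 5] : Fin 2 → ℕ) i))⁻¹) :
    rootζ 8 ^ 7 - (rootζ 8 ^ 7)⁻¹ = Complex.I * (Real.sqrt ((2 : ℕ) : ℝ) : ℂ) ∨
      rootζ 8 ^ 7 - (rootζ 8 ^ 7)⁻¹ = -(Complex.I * (Real.sqrt ((2 : ℕ) : ℝ) : ℂ)) := by
  obtain ⟨h2, -⟩ := ncard_slot_zero_eq h0 hΦ hind hL0 a ha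
  have hne : {s : L 0 →+* ℂ | s ∈ (Ψ 0).1 ∧ s (a 0 : L 0) = rootζ 8 ^ 7 - (rootζ 8 ^ 7)⁻¹}.Nonempty :=
    Set.nonempty_of_ncard_ne_zero (by rw [h2]; norm_num)
  obtain ⟨s, -, hs⟩ := hne
  apply eq_or_eq_neg_of_sq_eq_neg_two
  have hK := sub_inv_sq_of_pow_four (pow_exp_pow_four_eq_neg_one (K := K) h0 h1 0)
  rw [← ha 0] at hK
  have ha2 : ((a 0 : 𝓞 (L 0)) : L 0) ^ 2 = -2 := by
    apply (algebraMap (L 0) (K 0)).injective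
    rw [map_pow, map_neg, map_ofNat]
    exact hK
  rw [← hs, ← map_pow, ha2, map_neg, map_ofNat]

/-- **The refined slot-1 counts**: `#{ρ ∈ Ψ_1 : ρ(a_1) = c₈} = 1` and `#{ρ ∈ Ψ_1 : ρ(a_1) = −c₈} = 3` (F47's `(1,3)` on `Ψ_{40}`, read against F50's
value `c₈`). [cite: MoonenZarhin1999LowDim, §5 Case 2 («multiplicities (1,3)»)] -/
theorem ncard_slot_one_eq (h0 : lev 0 = 8) (h1 : lev 1 = 40)
    (hΦ : ∀ i (σ : K i →+* ℂ), σ ∈ (Φ i).1 ↔ 2 * (expOf (lev i) (K i) σ).val < lev i)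
    (hind : ∀ i, inducedCMType (algebraMap (L i) (K i)) (Ψ i) = Φ i) (hL0 : L 0 = ⊤) (hfin1 : Module.finrank (L 1) (K 1) = 2)
    (a : ∀ i, 𝓞 (L i))
    (ha : ∀ i, (((a i : L i)) : K i) = zetaOf (lev i) (K i) ^ ((![7, 5] : Fin 2 → ℕ) i) - (zetaOf (lev i) (K i) ^ ((![7, 5] : Fin 2 → ℕ) i))⁻¹) :
    {ρ : L 1 →+* ℂ | ρ ∈ (Ψ 1).1 ∧ ρ (a 1 : L 1) = rootζ 8 ^ 7 - (rootζ 8 ^ 7)⁻¹}.ncard = 1 ∧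
      {ρ : L 1 →+* ℂ | ρ ∈ (Ψ 1).1 ∧ ρ (a 1 : L 1) = -(rootζ 8 ^ 7 - (rootζ 8 ^ 7)⁻¹)}.ncard = 3 := by
  obtain ⟨hI, hnI⟩ := sum_ncard_slots_eq h0 h1 hΦ hind hL0 hfin1 a ha
  obtain ⟨h2, hz⟩ := ncard_slot_zero_eq h0 hΦ hind hL0 a ha
  rw [Fin.sum_univ_two] at hI hnI
  rcases rootValue_eq_or h0 h1 hΦ hind hL0 a ha with h | h
  · rw [h] at h2 hz ⊢
    constructor <;> omega
  · rw [h] at h2 hz ⊢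
    rw [neg_neg] at hz ⊢
    constructor <;> omega

/-- **`T_a ∉ pohlmannDivisorSetsAlg Ψ 3`: THE WEIL FIBRE IS NOT A DIVISOR WEIGHT.**  Over `−c₈` the type `Ψ_0 = Φ_8` is EMPTY and `Ψ_1` has `3` of the
`4` embeddings; so the fibre of `−c₈` (which is `T_a` or `T̄_a`) contains an element `(1, ρ')`, `ρ' ∉ Ψ_1`, all of its members inside their types
sit in slot `1`, and `Ψ_1` is primitive (`Y_{40}` simple) — the single-slot obstruction (§1) applies; `T̄_a` divisorial iff `T_a` is.
[cite: MoonenZarhin1999LowDim, §5 Case 2] [cite: Gordon1999HodgeAVSurvey, 9.2.2] [cite: Shimura1998, §8.2 Prop. 26] -/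
theorem weilFibre_not_mem_pohlmannDivisorSetsAlg {B : AbelianVariety ℂ} {ιB : 𝓞 (L 1) →+* End B}
    {θB : L 1 →+* Module.End ℂ (complexBetti B.X 1)} (h0 : lev 0 = 8) (h1 : lev 1 = 40)
    (hΦ : ∀ i (σ : K i →+* ℂ), σ ∈ (Φ i).1 ↔ 2 * (expOf (lev i) (K i) σ).val < lev i)
    (hind : ∀ i, inducedCMType (algebraMap (L i) (K i)) (Ψ i) = Φ i) (hL0 : L 0 = ⊤) (hfin1 : Module.finrank (L 1) (K 1) = 2)
    (a : ∀ i, 𝓞 (L i))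
    (ha : ∀ i, (((a i : L i)) : K i) = zetaOf (lev i) (K i) ^ ((![7, 5] : Fin 2 → ℕ) i) - (zetaOf (lev i) (K i) ^ ((![7, 5] : Fin 2 → ℕ) i))⁻¹)
    (hB : IsCMTypeRealisation (Ψ 1) B ιB θB) (hs : B.IsSimple) (m : ℕ) :
    (Finset.univ.filter fun y : (i : Fin 2) × (L i →+* ℂ) =>
        y.2 ((a y.1 : 𝓞 (L y.1)) : L y.1) = Complex.I * (Real.sqrt ((2 : ℕ) : ℝ) : ℂ)) ∉ pohlmannDivisorSetsAlg Ψ m := by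
  haveI : ∀ i, IsCMField (L i) := isCMField_sub (two_lt_lev h0 h1) Ψ
  have ha2 := sq_a_eq h0 h1 a ha
  obtain ⟨φ₀⟩ := (inferInstance : Nonempty (L 1 →+* ℂ))
  have hprim := (isSimple_iff_isPrimitive hB φ₀).1 hs
  set v : ℂ := rootζ 8 ^ 7 - (rootζ 8 ^ 7)⁻¹ with hv
  obtain ⟨h1v, h3v⟩ := ncard_slot_one_eq h0 h1 hΦ hind hL0 hfin1 a ha
  obtain ⟨-, hz⟩ := ncard_slot_zero_eq h0 hΦ hind hL0 a ha
  have hvμ := rootValue_eq_or h0 h1 hΦ hind hL0 a ha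
  -- the conjugate of `v` is `−v`, and `v ≠ −v`
  have hμconj : starRingEnd ℂ (Complex.I * (Real.sqrt ((2 : ℕ) : ℝ) : ℂ)) = -(Complex.I * (Real.sqrt ((2 : ℕ) : ℝ) : ℂ)) := by
    rw [map_mul, Complex.conj_I, Complex.conj_ofReal, neg_mul]
  rw [← hv] at hvμ
  have hvconj : starRingEnd ℂ v = -v := by
    rcases hvμ with h | h
    · rw [h, hμconj]
    · rw [h, map_neg, hμconj]
  have hμ0 : Complex.I * (Real.sqrt ((2 : ℕ) : ℝ) : ℂ) ≠ 0 :=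
    mul_ne_zero Complex.I_ne_zero (by exact_mod_cast Real.sqrt_ne_zero'.2 (by norm_num))
  have hv0 : v ≠ 0 := by
    rcases hvμ with h | h
    · rw [h]; exact hμ0
    · rw [h]; exact neg_ne_zero.2 hμ0
  have hvne : -v ≠ v := fun h => by
    have h2 : (2 : ℂ) * v = 0 := by rw [two_mul]; exact neg_eq_iff_add_eq_zero.1 h
    exact hv0 ((mul_eq_zero.1 h2).resolve_left two_ne_zero)
  -- an element `ρ₁ ∈ Ψ_1` over `v`; its conjugate `ρ' ∉ Ψ_1` lies over `−v`
  obtain ⟨ρ₁, hρ₁⟩ := Set.ncard_eq_one.1 h1v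
  have hρ₁' : ρ₁ ∈ (Ψ 1).1 ∧ ρ₁ (a 1 : L 1) = v := by
    have : ρ₁ ∈ ({ρ₁} : Set (L 1 →+* ℂ)) := Set.mem_singleton _
    rw [← hρ₁] at this
    exact this
  have hρ'not : ComplexEmbedding.conjugate ρ₁ ∉ (Ψ 1).1 := ((Ψ 1).2 ρ₁).1 hρ₁'.1
  have hρ'val : ComplexEmbedding.conjugate ρ₁ (a 1 : L 1) = -v := by
    rw [ComplexEmbedding.conjugate_coe_eq, hρ₁'.2, hvconj]
  -- the fibre of `−v` is not divisorial (single-slot obstruction at slot `1`)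
  have hS : (Finset.univ.filter fun y : (i : Fin 2) × (L i →+* ℂ) => y.2 ((a y.1 : 𝓞 (L y.1)) : L y.1) = -v) ∉
      pohlmannDivisorSetsAlg Ψ m := by
    refine not_mem_pohlmannDivisorSetsAlg_of_sameSlot (Φ := Ψ) (i₀ := 1) φ₀ hprim (ρ := ComplexEmbedding.conjugate ρ₁) ?_ hρ'not ?_ ?_ m
    · simp only [Finset.mem_filter, Finset.mem_univ, true_and]
      exact hρ'val
    · rintro ⟨i, s⟩ hy hyΨ
      simp only [Finset.mem_filter, Finset.mem_univ, true_and] at hy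
      rcases Fin.eq_zero_or_eq_succ i with rfl | ⟨j, rfl⟩
      · exfalso
        have hmem : s ∈ {s : L 0 →+* ℂ | s ∈ (Ψ 0).1 ∧ s (a 0 : L 0) = -v} := ⟨hyΨ, hy⟩
        rw [(Set.ncard_eq_zero (Set.toFinite _)).1 hz] at hmem
        exact hmem
      · have hj := Fin.fin_one_eq_zero j
        subst hj
        rfl
    · intro hmem
      simp only [Finset.mem_filter, Finset.mem_univ, true_and] at hmem
      rw [(ComplexEmbedding.involutive_conjugate (L 1)) ρ₁, hρ₁'.2] at hmem
      exact hvne hmem.symm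
  -- `T_a` or `T̄_a` is that fibre
  rcases hvμ with h | h
  · -- `v = i√2`: the fibre of `−v` is `T̄_a`
    intro hT
    apply hS
    have heq : (Finset.univ.filter fun y : (i : Fin 2) × (L i →+* ℂ) => y.2 ((a y.1 : 𝓞 (L y.1)) : L y.1) = -v) =
        (starRingAut : ℂ ≃+* ℂ) • (Finset.univ.filter fun y : (i : Fin 2) × (L i →+* ℂ) =>
          y.2 ((a y.1 : 𝓞 (L y.1)) : L y.1) = Complex.I * (Real.sqrt ((2 : ℕ) : ℝ) : ℂ)) := by
      ext x
      rw [CorankOne.mem_conj_smul_weilFibre_iff a two_pos ha2 x]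
      simp only [Finset.mem_filter, Finset.mem_univ, true_and, h]
    rw [heq]
    exact CorankOne.smul_mem_pohlmannDivisorSetsAlg _ hT
  · -- `v = −i√2`: the fibre of `−v` is `T_a`
    have heq : (Finset.univ.filter fun y : (i : Fin 2) × (L i →+* ℂ) => y.2 ((a y.1 : 𝓞 (L y.1)) : L y.1) = -v) =
        (Finset.univ.filter fun y : (i : Fin 2) × (L i →+* ℂ) =>
          y.2 ((a y.1 : 𝓞 (L y.1)) : L y.1) = Complex.I * (Real.sqrt ((2 : ℕ) : ℝ) : ℂ)) := by
      simp only [h, neg_neg]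
    rw [← heq]
    exact hS

end Counts

/-! ## §4 On realisations `X_8 ⊨ (ℚ(ζ_8); Φ_8)`, `Y_{40} ⊨ (L_1; Ψ_1)` simple: WEIL TYPE `(3, 2)` and `W_k ⊄ D³ ⊗ ℂ` -/

section Geometry

variable {lev : Fin 2 → ℕ} [∀ i, NeZero (lev i)] {K : Fin 2 → Type} [∀ i, Field (K i)] [∀ i, NumberField (K i)]
  [∀ i, IsCyclotomicExtension {lev i} ℚ (K i)] {Φ : ∀ i, CMType (K i)}
  {L : ∀ i, IntermediateField ℚ (K i)} {Ψ : ∀ i, CMType (L i)}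
  {B : Fin 2 → AbelianVariety ℂ} {ιB : ∀ i, 𝓞 (L i) →+* End (B i)} {θB : ∀ i, L i →+* Module.End ℂ (complexBetti (B i).X 1)}

/-- **The dimensions: `dim X_8 = 2`, `dim Y_{40} = 4`, `dim(X_8 ⊕ Y_{40}) = 6`.** [cite: GalleseGoodsonLombardo2024, §3 Thm. 3.0 (5)] -/
theorem dim_eq (h0 : lev 0 = 8) (h1 : lev 1 = 40) (hL0 : L 0 = ⊤) (hfin1 : Module.finrank (L 1) (K 1) = 2)
    (hB : ∀ i, IsCMTypeRealisation (Ψ i) (B i) (ιB i) (θB i)) : (B 0).dim = 2 ∧ (B 1).dim = 4 ∧ (⨁ B).dim = 6 := by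
  obtain ⟨hd0, hd1⟩ := finrank_eq (K := K) h0 h1 hL0 hfin1
  have e0 := finrank_eq_two_mul_dim_of_isCMTypeRealisation (hB 0)
  have e1 := finrank_eq_two_mul_dim_of_isCMTypeRealisation (hB 1)
  haveI : ∀ i, IsCMField (L i) := isCMField_sub (two_lt_lev h0 h1) Ψ
  have e := CorankOne.dim_biproduct_eq hB
  rw [sum_finrank_eq h0 h1 hL0 hfin1] at e
  omega

/-- **`(X_8 ⊕ Y_{40}, ι(a_0) ⊕ ι(a_1))` IS OF WEIL TYPE `(3, 2)`**: `φ = ι_0(ζ_8⁷ − ζ_8^{−7}) ⊕ ι_1(ζ_{40}⁵ − ζ_{40}^{−5})` has `φ² = −2` and `i√2` is an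
eigenvalue of `φ^*` on `H^{1,0}` of multiplicity `3 = dim/2` — Moonen–Zarhin's sixfold `Z = E² × Y` of §5 Case 2 is of Weil type for `k = ℚ(√−2)`
(van Geemen 4.9), here for its isogenous model `X_8 × Y_{40} ⊂ J_{40}` at the level of Hodge structures (F50 had the CM-type level).
[cite: MoonenZarhin1999LowDim, §5 Case 2] [cite: vanGeemen1994HodgeAV, 4.9 and Lemma 5.2] [cite: Deligne1982HodgeCycles, §4 Prop. 4.4] -/
theorem isWeilType (h0 : lev 0 = 8) (h1 : lev 1 = 40)
    (hΦ : ∀ i (σ : K i →+* ℂ), σ ∈ (Φ i).1 ↔ 2 * (expOf (lev i) (K i) σ).val < lev i)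
    (hind : ∀ i, inducedCMType (algebraMap (L i) (K i)) (Ψ i) = Φ i) (hL0 : L 0 = ⊤) (hfin1 : Module.finrank (L 1) (K 1) = 2)
    (a : ∀ i, 𝓞 (L i))
    (ha : ∀ i, (((a i : L i)) : K i) = zetaOf (lev i) (K i) ^ ((![7, 5] : Fin 2 → ℕ) i) - (zetaOf (lev i) (K i) ^ ((![7, 5] : Fin 2 → ℕ) i))⁻¹)
    (hB : ∀ i, IsCMTypeRealisation (Ψ i) (B i) (ιB i) (θB i)) :
    IsWeilType (⨁ B) (biproduct.map fun i => ιB i (a i)) 3 2 := by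
  haveI : ∀ i, IsCMField (L i) := isCMField_sub (two_lt_lev h0 h1) Ψ
  exact CorankOne.isWeilType hB a two_pos (sq_a_eq h0 h1 a ha) (m := 3) (by norm_num)
    (by rw [sum_finrank_eq h0 h1 hL0 hfin1]) (isGaloisBalancedAlg_weilFibre h0 h1 hΦ hind hL0 hfin1 a ha)

/-- **The two Weil eigenlines of `H⁶(X_8 ⊕ Y_{40})` are the weight lines of `T_a` and `T̄_a`**: `H⁶_{T_a} ⊕ H⁶_{T̄_a} ≤ W_{ℚ(√−2)} ⊗ ℂ =
weilClassesOf (X_8 ⊕ Y_{40}) φ 3 2`. [cite: vanGeemen1994HodgeAV, 4.7 and Lemma 5.2] [cite: MoonenZarhin1999LowDim, §5 Case 2] -/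
theorem weightClassesAlg_weilFibre_le_weilClassesOf (h0 : lev 0 = 8) (h1 : lev 1 = 40)
    (hΦ : ∀ i (σ : K i →+* ℂ), σ ∈ (Φ i).1 ↔ 2 * (expOf (lev i) (K i) σ).val < lev i)
    (hind : ∀ i, inducedCMType (algebraMap (L i) (K i)) (Ψ i) = Φ i) (hL0 : L 0 = ⊤) (hfin1 : Module.finrank (L 1) (K 1) = 2)
    (a : ∀ i, 𝓞 (L i))
    (ha : ∀ i, (((a i : L i)) : K i) = zetaOf (lev i) (K i) ^ ((![7, 5] : Fin 2 → ℕ) i) - (zetaOf (lev i) (K i) ^ ((![7, 5] : Fin 2 → ℕ) i))⁻¹) :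
    weightClassesAlg B ιB (2 * 3) (Finset.univ.filter fun y : (i : Fin 2) × (L i →+* ℂ) =>
        y.2 ((a y.1 : 𝓞 (L y.1)) : L y.1) = Complex.I * (Real.sqrt ((2 : ℕ) : ℝ) : ℂ)) ≤
        weilClassesOf (⨁ B) (biproduct.map fun i => ιB i (a i)) 3 2 ∧
      weightClassesAlg B ιB (2 * 3) ((starRingAut : ℂ ≃+* ℂ) • Finset.univ.filter fun y : (i : Fin 2) × (L i →+* ℂ) =>
        y.2 ((a y.1 : 𝓞 (L y.1)) : L y.1) = Complex.I * (Real.sqrt ((2 : ℕ) : ℝ) : ℂ)) ≤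
        weilClassesOf (⨁ B) (biproduct.map fun i => ιB i (a i)) 3 2 := by
  haveI : ∀ i, IsCMField (L i) := isCMField_sub (two_lt_lev h0 h1) Ψ
  exact CorankOne.weightClassesAlg_weilFibre_le a two_pos (sq_a_eq h0 h1 a ha)
    (weilFibre_mem_pohlmannSetsAlg h0 h1 hΦ hind hL0 hfin1 a ha).1

/-- **`W_{ℚ(√−2)} ⊗ ℂ ⊄ D³(X_8 ⊕ Y_{40}) ⊗ ℂ`**: the Weil plane of `(X_8 ⊕ Y_{40}, φ)` contains the weight line of the NON-divisorial balanced weight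
`T_a`, which is not inside the span of products of divisor classes (§1) — Moonen–Zarhin's «`W_k ⊂ H⁶(Z, ℚ)` consists of Hodge classes» that are
EXCEPTIONAL, at the level of Hodge structures inside `J_{40}`. [cite: MoonenZarhin1999LowDim, §5 Case 2 and Thm. 0.2 (3)] [cite: Gordon1999HodgeAVSurvey, 9.2.2] -/
theorem not_weilClassesOf_le_divisorClassesSpan (h0 : lev 0 = 8) (h1 : lev 1 = 40)
    (hΦ : ∀ i (σ : K i →+* ℂ), σ ∈ (Φ i).1 ↔ 2 * (expOf (lev i) (K i) σ).val < lev i)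
    (hind : ∀ i, inducedCMType (algebraMap (L i) (K i)) (Ψ i) = Φ i) (hL0 : L 0 = ⊤) (hfin1 : Module.finrank (L 1) (K 1) = 2)
    (a : ∀ i, 𝓞 (L i))
    (ha : ∀ i, (((a i : L i)) : K i) = zetaOf (lev i) (K i) ^ ((![7, 5] : Fin 2 → ℕ) i) - (zetaOf (lev i) (K i) ^ ((![7, 5] : Fin 2 → ℕ) i))⁻¹)
    (hB : ∀ i, IsCMTypeRealisation (Ψ i) (B i) (ιB i) (θB i)) (hs1 : (B 1).IsSimple) :
    ¬ weilClassesOf (⨁ B) (biproduct.map fun i => ιB i (a i)) 3 2 ≤ divisorClassesSpan (⨁ B).X (⨁ B).dim 3 := by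
  haveI : ∀ i, IsCMField (L i) := isCMField_sub (two_lt_lev h0 h1) Ψ
  intro hle
  have hTm := weilFibre_mem_pohlmannSetsAlg h0 h1 hΦ hind hL0 hfin1 a ha
  exact not_weightClassesAlg_le_divisorClassesSpan hB hTm.1
    (weilFibre_not_mem_pohlmannDivisorSetsAlg h0 h1 hΦ hind hL0 hfin1 a ha (hB 1) hs1 3)
    ((weightClassesAlg_weilFibre_le_weilClassesOf h0 h1 hΦ hind hL0 hfin1 a ha).1.trans hle)

/-- **Every Weil class of `(X_8 ⊕ Y_{40}, φ)` is of Hodge type `(3,3)`** (Weil type, van Geemen 4.10 ∕ Deligne–Milne 4.4).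
[cite: vanGeemen1994HodgeAV, 4.10 and Lemma 5.2] [cite: MoonenZarhin1999LowDim, §5 Case 2] -/
theorem isOfHodgeType_of_mem_weilClassesOf (h0 : lev 0 = 8) (h1 : lev 1 = 40)
    (hΦ : ∀ i (σ : K i →+* ℂ), σ ∈ (Φ i).1 ↔ 2 * (expOf (lev i) (K i) σ).val < lev i)
    (hind : ∀ i, inducedCMType (algebraMap (L i) (K i)) (Ψ i) = Φ i) (hL0 : L 0 = ⊤) (hfin1 : Module.finrank (L 1) (K 1) = 2)
    (a : ∀ i, 𝓞 (L i))
    (ha : ∀ i, (((a i : L i)) : K i) = zetaOf (lev i) (K i) ^ ((![7, 5] : Fin 2 → ℕ) i) - (zetaOf (lev i) (K i) ^ ((![7, 5] : Fin 2 → ℕ) i))⁻¹)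
    (hB : ∀ i, IsCMTypeRealisation (Ψ i) (B i) (ιB i) (θB i)) {c : complexBetti (⨁ B).X (2 * 3)}
    (hc : c ∈ weilClassesOf (⨁ B) (biproduct.map fun i => ιB i (a i)) 3 2) :
    IsOfHodgeType (⨁ B).dim (⨁ B).X (2 * 3) 3 3 c := by
  obtain ⟨-, -, h6⟩ := dim_eq h0 h1 hL0 hfin1 hB
  rw [h6]
  exact (isWeilType h0 h1 hΦ hind hL0 hfin1 a ha hB).isOfHodgeType_of_mem_weilClassesOf hc

/-- **A RATIONAL `(3,3)` WEIL CLASS OF `X_8 ⊕ Y_{40}` OUTSIDE `D³ ⊗ ℂ`** (the Weil plane is spanned by its rational classes, tree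
`weilClassesOf_eq_span_isRationalClass`; if all of them were in `D³ ⊗ ℂ` so would be the plane): `B³(X_8 × Y_{40}) ≠ D³`, witnessed inside `W_k`.
[cite: MoonenZarhin1999LowDim, §5 Case 2] [cite: vanGeemen1994HodgeAV, 4.9] [cite: Gordon1999HodgeAVSurvey, 9.2.2] -/
theorem exists_rational_weilClass_not_mem_divisorClassesSpan (h0 : lev 0 = 8) (h1 : lev 1 = 40)
    (hΦ : ∀ i (σ : K i →+* ℂ), σ ∈ (Φ i).1 ↔ 2 * (expOf (lev i) (K i) σ).val < lev i)
    (hind : ∀ i, inducedCMType (algebraMap (L i) (K i)) (Ψ i) = Φ i) (hL0 : L 0 = ⊤) (hfin1 : Module.finrank (L 1) (K 1) = 2)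
    (a : ∀ i, 𝓞 (L i))
    (ha : ∀ i, (((a i : L i)) : K i) = zetaOf (lev i) (K i) ^ ((![7, 5] : Fin 2 → ℕ) i) - (zetaOf (lev i) (K i) ^ ((![7, 5] : Fin 2 → ℕ) i))⁻¹)
    (hB : ∀ i, IsCMTypeRealisation (Ψ i) (B i) (ιB i) (θB i)) (hs1 : (B 1).IsSimple) :
    ∃ c ∈ weilClassesOf (⨁ B) (biproduct.map fun i => ιB i (a i)) 3 2, IsRationalClass c ∧
      IsOfHodgeType (⨁ B).dim (⨁ B).X (2 * 3) 3 3 c ∧ c ∉ divisorClassesSpan (⨁ B).X (⨁ B).dim 3 := by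
  have hWT := isWeilType h0 h1 hΦ hind hL0 hfin1 a ha hB
  by_contra hall
  push Not at hall
  apply not_weilClassesOf_le_divisorClassesSpan h0 h1 hΦ hind hL0 hfin1 a ha hB hs1
  rw [weilClassesOf_eq_span_isRationalClass hWT.pos hWT.dim_eq hWT.d_pos hWT.sq_eq]
  refine Submodule.span_le.2 fun c hc => ?_
  exact hall c hc.2 hc.1 (isOfHodgeType_of_mem_weilClassesOf h0 h1 hΦ hind hL0 hfin1 a ha hB hc.2)

/-- **`B³(X_8 ⊕ Y_{40}) ⊗ ℂ ≠ D³ ⊗ ℂ`** (an exceptional Hodge class in the middle degree of the sixfold).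
[cite: MoonenZarhin1999LowDim, §5 Case 2 and Thm. 0.2 (3)] [cite: Gordon1999HodgeAVSurvey, 9.2.2] -/
theorem hodgeClassSpan_ne_divisorClassesSpan (h0 : lev 0 = 8) (h1 : lev 1 = 40)
    (hΦ : ∀ i (σ : K i →+* ℂ), σ ∈ (Φ i).1 ↔ 2 * (expOf (lev i) (K i) σ).val < lev i)
    (hind : ∀ i, inducedCMType (algebraMap (L i) (K i)) (Ψ i) = Φ i) (hL0 : L 0 = ⊤) (hfin1 : Module.finrank (L 1) (K 1) = 2)
    (a : ∀ i, 𝓞 (L i))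
    (ha : ∀ i, (((a i : L i)) : K i) = zetaOf (lev i) (K i) ^ ((![7, 5] : Fin 2 → ℕ) i) - (zetaOf (lev i) (K i) ^ ((![7, 5] : Fin 2 → ℕ) i))⁻¹)
    (hB : ∀ i, IsCMTypeRealisation (Ψ i) (B i) (ιB i) (θB i)) (hs1 : (B 1).IsSimple) :
    hodgeClassSpan (⨁ B).dim (⨁ B).X 3 ≠ divisorClassesSpan (⨁ B).X (⨁ B).dim 3 := by
  obtain ⟨c, -, hcQ, hcH, hcD⟩ := exists_rational_weilClass_not_mem_divisorClassesSpan h0 h1 hΦ hind hL0 hfin1 a ha hB hs1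
  intro h
  exact hcD (h ▸ Submodule.subset_span ⟨hcQ, hcH⟩)

end Geometry

/-! ## §5 The data exist inside `J_{40}`, and a hypothesis-free sixfold of Weil type `(3, 2)` with exceptional Weil classes -/

section Existence

variable {lev : Fin 2 → ℕ} [∀ i, NeZero (lev i)] {K : Fin 2 → Type} [∀ i, Field (K i)] [∀ i, NumberField (K i)]
  [∀ i, IsCyclotomicExtension {lev i} ℚ (K i)] {Φ : ∀ i, CMType (K i)}
  {A : Fin 2 → AbelianVariety ℂ} {ι : ∀ i, 𝓞 (K i) →+* End (A i)} {θ : ∀ i, K i →+* Module.End ℂ (complexBetti (A i).X 1)}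

/-- **The data on realisations `A_0 ⊨ (ℚ(ζ_8); Φ_8)`, `A_1 ⊨ (ℚ(ζ_{40}); Φ_{40})`**: `A_0` kept whole along `⊤`, the simple factor `B_1 = Y_{40}` of
`A_1 ∼ B_1²` (CM field `ℚ(ζ_{40} − ζ_{40}^{−1})` of index `2`, GGL Thm. 3.0 (5)), a CM elliptic curve `E` with `A_0 ∼ E²`, and the diagonal `√−2`:
`a = (ζ_8⁷ − ζ_8^{−7}, ζ_{40}⁵ − ζ_{40}^{−5}) ∈ 𝓞_{L_0} × 𝓞_{L_1}` (F46: `ζ⁵ − ζ^{−5} ∈ ℚ(ζ − ζ^{−1})`). [cite: GalleseGoodsonLombardo2024, §3 Thm. 3.0 (5)]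
[cite: MoonenZarhin1999LowDim, §5 Case 2] -/
theorem exists_data (h0 : lev 0 = 8) (h1 : lev 1 = 40)
    (hΦ : ∀ i (σ : K i →+* ℂ), σ ∈ (Φ i).1 ↔ 2 * (expOf (lev i) (K i) σ).val < lev i)
    (hA : ∀ i, IsCMTypeRealisation (Φ i) (A i) (ι i) (θ i)) :
    ∃ (L : ∀ i, IntermediateField ℚ (K i)) (Ψ : ∀ i, CMType (L i)) (B : Fin 2 → AbelianVariety ℂ)
      (ιB : ∀ i, 𝓞 (L i) →+* End (B i)) (θB : ∀ i, L i →+* Module.End ℂ (complexBetti (B i).X 1)) (a : ∀ i, 𝓞 (L i)),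
      (∀ i, inducedCMType (algebraMap (L i) (K i)) (Ψ i) = Φ i) ∧ (∀ i, IsCMTypeRealisation (Ψ i) (B i) (ιB i) (θB i)) ∧
      L 0 = ⊤ ∧ B 0 = A 0 ∧ Module.finrank (L 1) (K 1) = 2 ∧ (B 1).IsSimple ∧ (B 0).dim = 2 ∧ (B 1).dim = 4 ∧
      IsIsogenous (A 1) (⨁ fun _ : Fin 2 => B 1) ∧
      (∃ E : AbelianVariety ℂ, E.IsSimple ∧ E.dim = 1 ∧ IsIsogenous (A 0) (⨁ fun _ : Fin 2 => E)) ∧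
      ∀ i, (((a i : L i)) : K i) = zetaOf (lev i) (K i) ^ ((![7, 5] : Fin 2 → ℕ) i) - (zetaOf (lev i) (K i) ^ ((![7, 5] : Fin 2 → ℕ) i))⁻¹ := by
  -- the data, uniformly in the member: slot 0 kept whole, slot 1 the simple factor
  have key : ∀ i : Fin 2, ∃ (L : IntermediateField ℚ (K i)) (Ψ : CMType L) (B : AbelianVariety ℂ) (ιB : 𝓞 L →+* End B)
      (θB : L →+* Module.End ℂ (complexBetti B.X 1)),
      inducedCMType (algebraMap L (K i)) Ψ = Φ i ∧ IsCMTypeRealisation Ψ B ιB θB ∧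
      (lev i = 8 → L = ⊤ ∧ B = A i) ∧
      (lev i ≠ 8 → Module.finrank L (K i) = 2 ∧ B.IsSimple ∧ 4 * B.dim = Nat.totient (lev i) ∧ IsIsogenous (A i) (⨁ fun _ : Fin 2 => B)) ∧
      zetaOf (lev i) (K i) ^ ((![7, 5] : Fin 2 → ℕ) i) - (zetaOf (lev i) (K i) ^ ((![7, 5] : Fin 2 → ℕ) i))⁻¹ ∈ L := by
    refine Fin.forall_fin_two.2 ⟨?_, ?_⟩
    · obtain ⟨L, Ψ, ιB, θB, hL, hind, hB⟩ := exists_top_subPair (Φ 0) (hA 0)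
      exact ⟨L, Ψ, A 0, ιB, θB, hind, hB, fun _ => ⟨hL, rfl⟩, fun h => absurd h0 h, by rw [hL]; exact IntermediateField.mem_top⟩
    · obtain ⟨L, Ψ, B, ιB, θB, -, -, -, hind, hfin, hL, -, hB, hs, hdim, hiso, -, -⟩ :=
        exists_simpleFactor_retract (d := lev 1) ⟨10, by rw [h1]⟩ (by rw [h1]; norm_num) (by rw [h1]; norm_num) (by rw [h1]; norm_num)
          (by rw [h1]; norm_num) (hΦ 1) (hA 1)
      obtain ⟨hmem, -⟩ := zetaOf_pow_sub_inv_mem_and_sq_eq_neg_two_of_eq_adjoin (K := K 1) (q := 5) ⟨2, rfl⟩ (by rw [h1])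
        (by rw [h1]; norm_num) (hΦ 1) hL
      exact ⟨L, Ψ, B, ιB, θB, hind, hB, fun h => absurd h (by rw [h1]; norm_num), fun _ => ⟨hfin, hs, hdim, hiso⟩, hmem⟩
  choose L Ψ B ιB θB hind hB hkeep hfac hmem using key
  obtain ⟨hL0, hB0eq⟩ := hkeep 0 h0
  obtain ⟨hfin1, hs1, hdim1, hiso1⟩ := hfac 1 (by rw [h1]; norm_num)
  -- the CM curve `E` with `A_0 ∼ E²`
  obtain ⟨-, -, E, -, -, -, -, -, -, -, -, -, -, hEs, hEdim, hEiso, -, -⟩ :=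
    exists_simpleFactor_retract (d := lev 0) ⟨2, by rw [h0]⟩ (by rw [h0]) (by rw [h0]; norm_num) (by rw [h0]; norm_num)
      (by rw [h0]; norm_num) (hΦ 0) (hA 0)
  -- integrality of `ζ^c − ζ^{−c}` (a difference of roots of unity)
  have hint : ∀ i, IsIntegral ℤ (⟨zetaOf (lev i) (K i) ^ ((![7, 5] : Fin 2 → ℕ) i) -
      (zetaOf (lev i) (K i) ^ ((![7, 5] : Fin 2 → ℕ) i))⁻¹, hmem i⟩ : L i) := fun i => by
    rw [← isIntegral_algebraMap_iff (algebraMap (L i) (K i)).injective]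
    have hζ : IsPrimitiveRoot (zetaOf (lev i) (K i)) (lev i) := IsCyclotomicExtension.zeta_spec (lev i) ℚ (K i)
    have hζi : IsIntegral ℤ (zetaOf (lev i) (K i)) := hζ.isIntegral (NeZero.pos _)
    have hinv : (zetaOf (lev i) (K i) ^ ((![7, 5] : Fin 2 → ℕ) i))⁻¹ =
        (zetaOf (lev i) (K i) ^ ((![7, 5] : Fin 2 → ℕ) i)) ^ (lev i - 1) := by
      refine inv_eq_of_mul_eq_one_right ?_
      rw [← pow_succ', Nat.sub_add_cancel NeZero.one_le, ← pow_mul, mul_comm, pow_mul, hζ.pow_eq_one, one_pow]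
    show IsIntegral ℤ (zetaOf (lev i) (K i) ^ ((![7, 5] : Fin 2 → ℕ) i) - (zetaOf (lev i) (K i) ^ ((![7, 5] : Fin 2 → ℕ) i))⁻¹)
    rw [hinv]
    exact (hζi.pow _).sub ((hζi.pow _).pow _)
  have hd0 : (B 0).dim = 2 := by
    have h := IsCMTypeRealisation.two_mul_dim_eq_totient (m := lev 0) (two_lt_lev h0 h1 0) (hA 0)
    rw [h0, show Nat.totient 8 = 4 by decide] at h
    rw [hB0eq]
    omega
  have hd1 : (B 1).dim = 4 := by
    rw [h1, show Nat.totient 40 = 16 by decide] at hdim1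
    omega
  have hE1 : E.dim = 1 := by
    rw [h0, show Nat.totient 8 = 4 by decide] at hEdim
    omega
  exact ⟨L, Ψ, B, ιB, θB, fun i => ⟨⟨_, hmem i⟩, (mem_integralClosure_iff ℤ (L i)).2 (hint i)⟩, hind, hB, hL0, hB0eq, hfin1, hs1, hd0, hd1,
    hiso1, ⟨E, hEs, hE1, hEiso⟩, fun i => rfl⟩

/-- **MOONEN–ZARHIN §5 CASE 2, EXPLICIT AND AT THE LEVEL OF HODGE STRUCTURES**: there are an abelian SURFACE `S` isogenous to the square of a CM
elliptic curve (`S = X_8`, `E = E'` with CM by `ℚ(√−2)`) and a SIMPLE abelian FOURFOLD `Y` (`= Y_{40}`) with an endomorphism `φ` of `S ⊕ Y`, `φ² = −2`,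
such that the sixfold `(S ⊕ Y, φ)` is OF WEIL TYPE `(3, 2)`, every class of its Weil plane `W` is of Hodge type `(3,3)`, `W ⊄ D³ ⊗ ℂ`, and `W`
contains a RATIONAL `(3,3)`-class outside `D³ ⊗ ℂ` — «`Z := E² × Y` … `W_k ⊂ H⁶(Z, ℚ)` consists of Hodge classes», exceptional ones.
[cite: MoonenZarhin1999LowDim, §5 Case 2 and Thm. 0.2 (3)] [cite: vanGeemen1994HodgeAV, 4.9–4.10] [cite: GalleseGoodsonLombardo2024, §3 Thm. 3.0 (5)] -/
theorem exists_surface_fourfold_weilType_sixfold :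
    ∃ (X : Fin 2 → AbelianVariety ℂ) (φ : (⨁ X) ⟶ (⨁ X)),
      (X 0).dim = 2 ∧ (∃ E : AbelianVariety ℂ, E.IsSimple ∧ E.dim = 1 ∧ IsIsogenous (X 0) (⨁ fun _ : Fin 2 => E)) ∧
      (X 1).IsSimple ∧ (X 1).dim = 4 ∧ (⨁ X).dim = 6 ∧ φ ≫ φ = -((2 : ℕ) • 𝟙 (⨁ X)) ∧ IsWeilType (⨁ X) φ 3 2 ∧
      (∀ c ∈ weilClassesOf (⨁ X) φ 3 2, IsOfHodgeType (⨁ X).dim (⨁ X).X (2 * 3) 3 3 c) ∧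
      ¬ weilClassesOf (⨁ X) φ 3 2 ≤ divisorClassesSpan (⨁ X).X (⨁ X).dim 3 ∧
      (∃ c ∈ weilClassesOf (⨁ X) φ 3 2, IsRationalClass c ∧ IsOfHodgeType (⨁ X).dim (⨁ X).X (2 * 3) 3 3 c ∧
        c ∉ divisorClassesSpan (⨁ X).X (⨁ X).dim 3) ∧
      hodgeClassSpan (⨁ X).dim (⨁ X).X 3 ≠ divisorClassesSpan (⨁ X).X (⨁ X).dim 3 := by
  obtain ⟨K, _, _, _, _, Φ, A, ι, θ, hΦ, hA⟩ := exists_realisation_family (![8, 40] : Fin 2 → ℕ)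
    (Fin.forall_fin_two.2 ⟨by show (8 : ℕ) = 4 * (8 / 4); norm_num, by show (40 : ℕ) = 4 * (40 / 4); norm_num⟩)
    (Fin.forall_fin_two.2 ⟨by show 0 < 8 / 4; norm_num, by show 0 < 40 / 4; norm_num⟩)
  have h0 : (![8, 40] : Fin 2 → ℕ) 0 = 8 := rfl
  have h1 : (![8, 40] : Fin 2 → ℕ) 1 = 40 := rfl
  obtain ⟨L, Ψ, B, ιB, θB, a, hind, hB, hL0, hB0, hfin1, hs1, hd0, hd1, -, hE, ha⟩ := exists_data h0 h1 hΦ hA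
  have hWT := isWeilType h0 h1 hΦ hind hL0 hfin1 a ha hB
  obtain ⟨-, -, h6⟩ := dim_eq h0 h1 hL0 hfin1 hB
  refine ⟨B, biproduct.map fun i => ιB i (a i), hd0, by rw [hB0]; exact hE, hs1, hd1, h6, hWT.sq_eq, hWT,
    fun c hc => isOfHodgeType_of_mem_weilClassesOf h0 h1 hΦ hind hL0 hfin1 a ha hB hc,
    not_weilClassesOf_le_divisorClassesSpan h0 h1 hΦ hind hL0 hfin1 a ha hB hs1,
    exists_rational_weilClass_not_mem_divisorClassesSpan h0 h1 hΦ hind hL0 hfin1 a ha hB hs1,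
    hodgeClassSpan_ne_divisorClassesSpan h0 h1 hΦ hind hL0 hfin1 a ha hB hs1⟩

end Existence

end WeilPlaneForty

end HyperellipticJacobian

end Literature.AlgebraicGeometry.ComplexMultiplication

end
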